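import Mathlib
import Summits.Ventures.DiscreteObjects.Mahler.SmallMeasureCensus

/-!
# Smyth's constant `θ₀ = M(z³ - z - 1) = 1.3247…` in the kernel (venture `DiscreteObjects`, target L)

Cell `pub-namedobj`, seat `pub-namedobj-mahler` (gen 8). Framing: lottery ticket; floor = certified
bounds/negative ranges.

The constant of Smyth's theorem ([McKee–Smyth, *Around the Unit Circle*, Thm 12.1]: a nonreciprocal
integer polynomial has `M ≥ θ₀`): `θ₀` is the real root of `t³ = t + 1` (the smallest Pisot number),

* `smythTheta`, `smythTheta_cube`, `smythTheta_gt`/`smythTheta_lt` — `1.3247 < θ₀ < 1.3248`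
  (intermediate value theorem);
* `smythTheta_le_of_cube` — for `t ≥ 0`, `t³ ≥ t + 1` forces `θ₀ ≤ t` (monotonicity);
* `mahlerMeasure_X_cube_sub_X_sub_one` — `M(z³ - z - 1) = θ₀`, from the factorisation
  `z³ - z - 1 = (z - θ₀)(z - ζ)(z - ζ̄)` with `|ζ|² = θ₀² - 1 = 1/θ₀ < 1`;
* `intMahlerMeasure_X_cube_sub_X_sub_one` — the same for the cell's `intMahlerMeasure`.
-/

namespace Summit.Ventures.DiscreteObjects.Mahler

open Polynomial
open scoped ComplexConjugate

noncomputable section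

/-- There is a real number `θ` with `1.3247 < θ < 1.3248` and `θ³ = θ + 1`. -/
theorem exists_smythTheta :
    ∃ θ : ℝ, (13247 : ℝ) / 10000 < θ ∧ θ < 13248 / 10000 ∧ θ ^ 3 = θ + 1 := by
  have hcont : ContinuousOn (fun t : ℝ => t ^ 3 - t - 1) (Set.Icc (13247 / 10000 : ℝ) (13248 / 10000)) :=
    by fun_prop
  have hab : (13247 : ℝ) / 10000 ≤ 13248 / 10000 := by norm_num
  have h0 : (0 : ℝ) ∈ Set.Ioo ((fun t : ℝ => t ^ 3 - t - 1) (13247 / 10000))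
      ((fun t : ℝ => t ^ 3 - t - 1) (13248 / 10000)) := by
    constructor <;> norm_num
  obtain ⟨θ, ⟨h1, h2⟩, hθ⟩ := intermediate_value_Ioo hab hcont h0
  refine ⟨θ, h1, h2, ?_⟩
  have : θ ^ 3 - θ - 1 = 0 := hθ
  linarith

/-- **Smyth's constant** `θ₀ = 1.3247…`, the real root of `t³ = t + 1` (smallest Pisot number). -/
def smythTheta : ℝ := Classical.choose exists_smythTheta

/-- `θ₀ > 1.3247`. -/
theorem smythTheta_gt : (13247 : ℝ) / 10000 < smythTheta := (Classical.choose_spec exists_smythTheta).1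

/-- `θ₀ < 1.3248`. -/
theorem smythTheta_lt : smythTheta < 13248 / 10000 := (Classical.choose_spec exists_smythTheta).2.1

/-- `θ₀³ = θ₀ + 1`. -/
theorem smythTheta_cube : smythTheta ^ 3 = smythTheta + 1 := (Classical.choose_spec exists_smythTheta).2.2

/-- `θ₀ > 0`. -/
theorem smythTheta_pos : 0 < smythTheta := lt_trans (by norm_num) smythTheta_gt

/-- Monotonicity: a real `t ≥ 0` with `t³ ≥ t + 1` satisfies `θ₀ ≤ t`. -/
theorem smythTheta_le_of_cube {t : ℝ} (ht : 0 ≤ t) (h : t + 1 ≤ t ^ 3) : smythTheta ≤ t := by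
  by_contra hlt
  push Not at hlt
  have hθ := smythTheta_cube
  have hθ1 : 1 < smythTheta := lt_trans (by norm_num) smythTheta_gt
  -- `t³ - t - 1 - (θ³ - θ - 1) = (t - θ)(t² + tθ + θ² - 1) < 0`
  have hfac : t ^ 3 - t - 1 = (t - smythTheta) * (t ^ 2 + t * smythTheta + smythTheta ^ 2 - 1) := by
    nlinarith [hθ]
  have hpos : 0 < t ^ 2 + t * smythTheta + smythTheta ^ 2 - 1 := by nlinarith
  have hneg : (t - smythTheta) * (t ^ 2 + t * smythTheta + smythTheta ^ 2 - 1) < 0 :=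
    mul_neg_of_neg_of_pos (by linarith) hpos
  linarith

/-- Equivalently: `θ₀ ≤ t` as soon as `t > 0` and `1 ≤ t²·(t - 1/t)`-type bound `1/t² + 1/t³ ≤ 1`. -/
theorem smythTheta_le_of_inv {t : ℝ} (ht : 0 < t) (h : (t⁻¹) ^ 2 + (t⁻¹) ^ 3 ≤ 1) : smythTheta ≤ t := by
  apply smythTheta_le_of_cube ht.le
  have ht3 : 0 < t ^ 3 := by positivity
  have : ((t⁻¹) ^ 2 + (t⁻¹) ^ 3) * t ^ 3 ≤ 1 * t ^ 3 := by gcongr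
  have e : ((t⁻¹) ^ 2 + (t⁻¹) ^ 3) * t ^ 3 = t + 1 := by field_simp
  linarith

/-! ### `M(z³ - z - 1) = θ₀` -/

/-- The polynomial `z³ - z - 1` over `ℂ` factors as `(z - θ₀)(z - ζ)(z - ζ̄)` with
`ζ = (-θ₀ + i√(3θ₀² - 4))/2`, `|ζ|² = θ₀² - 1`. -/
theorem X_cube_sub_X_sub_one_eq_prod :
    ∃ ζ : ℂ, ‖ζ‖ < 1 ∧
      (X ^ 3 - X - 1 : ℂ[X]) = (X - C (smythTheta : ℂ)) * (X - C ζ) * (X - C (conj ζ)) := by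
  set θ : ℝ := smythTheta with hθdef
  have hθ := smythTheta_cube
  have hθgt := smythTheta_gt
  have hθlt := smythTheta_lt
  have hdisc : 0 ≤ 3 * θ ^ 2 - 4 := by nlinarith
  set s : ℝ := Real.sqrt (3 * θ ^ 2 - 4) with hs
  have hs2 : s ^ 2 = 3 * θ ^ 2 - 4 := by rw [hs]; exact Real.sq_sqrt hdisc
  set ζ : ℂ := (-(θ : ℂ) + (s : ℂ) * Complex.I) / 2 with hζ
  have hsum : ζ + conj ζ = -(θ : ℂ) := by
    rw [hζ]; simp only [map_div₀, map_add, map_neg, Complex.conj_ofReal, map_mul, Complex.conj_I,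
      map_ofNat]; ring
  have hprod : ζ * conj ζ = ((θ ^ 2 - 1 : ℝ) : ℂ) := by
    rw [hζ]; simp only [map_div₀, map_add, map_neg, Complex.conj_ofReal, map_mul, Complex.conj_I,
      map_ofNat]
    have hI : Complex.I * Complex.I = -1 := Complex.I_mul_I
    have e : (-(θ : ℂ) + (s : ℂ) * Complex.I) / 2 * ((-(θ : ℂ) + (s : ℂ) * -Complex.I) / 2) =
        ((θ : ℂ) ^ 2 - (s : ℂ) ^ 2 * (Complex.I * Complex.I)) / 4 := by ring
    rw [e, hI]; push_cast; rw [show (s : ℂ) ^ 2 = ((s ^ 2 : ℝ) : ℂ) by push_cast; ring, hs2]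
    push_cast; ring
  have hnorm : ‖ζ‖ ^ 2 = θ ^ 2 - 1 := by
    have h := Complex.mul_conj' ζ
    rw [hprod] at h
    exact_mod_cast h.symm
  have hθinv : θ ^ 2 - 1 < 1 := by nlinarith
  refine ⟨ζ, ?_, ?_⟩
  · have h0 : 0 ≤ ‖ζ‖ := norm_nonneg _
    nlinarith
  · have e1 : (X - C (θ : ℂ)) * (X - C ζ) * (X - C (conj ζ)) =
        X ^ 3 - C ((θ : ℂ) + (ζ + conj ζ)) * X ^ 2 + C ((θ : ℂ) * (ζ + conj ζ) + ζ * conj ζ) * X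
          - C ((θ : ℂ) * (ζ * conj ζ)) := by
      simp only [map_add, map_mul]; ring
    have c1 : (θ : ℂ) + (ζ + conj ζ) = 0 := by rw [hsum]; ring
    have c2 : (θ : ℂ) * (ζ + conj ζ) + ζ * conj ζ = -1 := by
      rw [hsum, hprod]; push_cast; ring
    have c3 : (θ : ℂ) * (ζ * conj ζ) = 1 := by
      rw [hprod]; push_cast
      have : (θ : ℂ) ^ 3 = θ + 1 := by exact_mod_cast hθ
      linear_combination this
    rw [e1, c1, c2, c3, map_zero, map_neg, map_one]; ring

/-- **`M(z³ - z - 1) = θ₀`.** -/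
theorem mahlerMeasure_X_cube_sub_X_sub_one :
    (X ^ 3 - X - 1 : ℂ[X]).mahlerMeasure = smythTheta := by
  obtain ⟨ζ, hζ, hfac⟩ := X_cube_sub_X_sub_one_eq_prod
  have hθ1 : 1 ≤ smythTheta := le_trans (by norm_num) smythTheta_gt.le
  rw [hfac, mahlerMeasure_mul, mahlerMeasure_mul, mahlerMeasure_X_sub_C, mahlerMeasure_X_sub_C,
    mahlerMeasure_X_sub_C, Complex.norm_conj, Complex.norm_real, Real.norm_eq_abs,
    abs_of_pos smythTheta_pos, max_eq_right hθ1, max_eq_left hζ.le, mul_one, mul_one]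

/-- `M(z³ - z - 1) = θ₀` for the integer polynomial (cell vocabulary `intMahlerMeasure`). -/
theorem intMahlerMeasure_X_cube_sub_X_sub_one :
    intMahlerMeasure (X ^ 3 - X - 1 : ℤ[X]) = smythTheta := by
  unfold intMahlerMeasure
  have : ((X ^ 3 - X - 1 : ℤ[X]).map (Int.castRingHom ℂ)) = (X ^ 3 - X - 1 : ℂ[X]) := by
    simp [Polynomial.map_sub, Polynomial.map_pow]
  rw [this, mahlerMeasure_X_cube_sub_X_sub_one]

/-- The Literature constant: `M(X³ - X - 1)` as written in `NonreciprocalMahlerBound` equals `θ₀`. -/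
theorem mahlerMeasure_map_X_cube_sub_X_sub_one :
    ((X ^ 3 - X - 1 : ℤ[X]).map (Int.castRingHom ℂ)).mahlerMeasure = smythTheta :=
  intMahlerMeasure_X_cube_sub_X_sub_one

end

end Summit.Ventures.DiscreteObjects.Mahler
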